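import Literature.NumberTheory.EllipticCurves.ZpExtensionEisensteinTwistedFilH2BoundProofs
import Literature.NumberTheory.EllipticCurves.TowerCoreLiftableIndexProofs
import Literature.NumberTheory.EllipticCurves.ZpExtensionEisensteinOrdinaryFilTransferProofs
import Literature.NumberTheory.EllipticCurves.ZpExtensionEisensteinOrdinaryFilSaturationProofs
import Literature.NumberTheory.EllipticCurves.TowerPresentedSubquotientCohomologyProofs
import Literature.NumberTheory.EllipticCurves.TowerLocalH1LiftExactProofs
import Literature.NumberTheory.EllipticCurves.TorsionFilAtCyclicOrdinaryProofs
import Literature.NumberTheory.EllipticCurves.ZpExtensionEisensteinTwistLocalH1BoundProofs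
import Literature.NumberTheory.GaloisRepresentations.LocalGlobalCohomologyFiniteProofs
import Literature.NumberTheory.EllipticCurves.ZpExtensionEisensteinOrdinaryCoreSaturationIndexProofs
import Literature.NumberTheory.EllipticCurves.ZpExtensionEisensteinOrdinaryFilSaturationMultiplicativeThreeProofs
import Literature.NumberTheory.EllipticCurves.TorsionFilAtCyclicMultiplicativeThreeProofs
import HarnessLib

/-!
# The saturation index of the strict ordinary cores at a place `v ∣ 3` of MULTIPLICATIVE reduction
# (theorems only — no definition, no named fact, no instance, no `sorry`)

Topic `NumberTheory/EllipticCurves` (LEAD `bsd-wall-utd-p1`, crux r205 stmt-BirchSwinnertonDyer-24737 `TwinAlgMuZeroAtThree`,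
line `beta-road`, stub `stub_howardOutputsOfFamily`, E2 assembly at `v ∣ 3`).  x9's
`ZpExtensionEisensteinOrdinaryCoreSaturationIndexProofs.natCard_ordinaryCore_quotient_levelCondition_le` assumes GOOD reduction with an
ordinary point, used only through the transfer/(ONTO)/(SAT) wrappers and the cyclic generator of `Fil_v E[p^n]`; at places of
MULTIPLICATIVE reduction above `3` these are `ZpExtensionEisensteinOrdinaryFilSaturationMultiplicativeThreeProofs` and
`TorsionFilAtCyclicMultiplicativeThreeProofs.exists_generator_torsionFilAt_of_hasMultiplicativeReductionAt_three`.  This file: x9's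
statement and proof at `p = 3` with `(hgood, hord)` replaced by `hmult` (generic § of x9's file imported).  BSD is not proved by any of this.

References: [Howard2004HeegnerKolyvagin] §3.2, Lemma 3.2.7; [GreenbergLNM1716] §2; [SerreGaloisCohomology1997] II §5.
-/

set_option autoImplicit false

noncomputable section

open Function NumberField IsDedekindDomain Field CategoryTheory
open scoped NumberField ContRepresentation

/-! ## §1 The cyclotomic character mod `p^k` as an integer prime to `p` -/

namespace WeierstrassCurve

open Literature.NumberTheory.EllipticCurves Literature.NumberTheory.GaloisRepresentations
open Literature.NumberTheory.GaloisRepresentations.DiscreteGaloisModule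
open Literature.NumberTheory.EllipticCurves.ZpExtension (EisensteinLevel)
open IwasawaAlgebra

variable {K : Type} [Field K] [NumberField K] (V : WeierstrassCurve K) [V.IsElliptic]
  (κ : ZpExtension K 3) {m : ℕ} (hm : 1 ≤ m) (v : HeightOneSpectrum (𝓞 K))

/-- **`#(core_i ⧸ core_i ∩ F_𝔮(v)_i) ≤ p^{p^s}` for the curve, uniformly in the level `i` and in `m`.**  At a place `v ∋ p` of good
reduction with an ordinary point, for `κ : ZpExtension K p`, `m ≥ 1`, `σ₀ ∈ Γ_{K_v}` with `κ(σ₀) = p^s` and `p^s < m`: the strict ordinary core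
`ordinaryCore i = ker (H¹(K_v, W_i) → H¹(K_v, W_i / Fil_v W_i))` of `W_i = E[p^i] ⊗ A_{m,i}(ψ)` meets Howard's SATURATED condition
`F_𝔮(v)_i = Tower.levelCondition (eisensteinLocalReduce …) p (ordinaryCore …) i` with index `≤ p^{p^s}`.  (The core is the image of
`H¹(K_v, Fil_v W_i)`; its stable part — classes liftable in the Fil sub-tower — lies in `F_𝔮(v)_i`, and the cokernels of the reductions of the
Fil sub-tower embed by `δ₁` into `H²(K_v, Fil_v W_n)`, of order `≤ p^{p^s}`.)
[cite: Howard2004HeegnerKolyvagin, Def. 2.1.1, §3.1 and Lemma 3.2.7 (arXiv:1202.6340 p. 15 L62–66, p. 16 L150–156)] [cite: MazurRubinMemoirs2004, Lemma 3.7.1]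
[cite: GreenbergLNM1716, §2–§3] -/
theorem natCard_ordinaryCore_quotient_levelCondition_le_of_hasMultiplicativeReductionAt_three (hpv : ((3 : ℕ) : 𝓞 K) ∈ v.asIdeal) (hmult : V.HasMultiplicativeReductionAt v)
    (σ₀ : absoluteGaloisGroup (v.adicCompletion K)) {s : ℕ}
    (hσ : (κ (absGaloisRestrict K (v.adicCompletion K) σ₀)).toAdd = ((3 ^ s : ℕ) : ℤ_[3])) (hms : 3 ^ s < m) (i : ℕ) :
    Nat.card (↥((V.ordinaryFiltrationAt v (fun j ↦ V.torsionGaloisModuleReduce 3 j) (fun _ _ ↦ rfl)).ordinaryCore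
        (κ := κ) hm i) ⧸
      (Tower.levelCondition
        (H := fun j ↦ galoisCohomology ((κ.eisensteinTwist (V.torsionGaloisModule (((3 : ℕ) : ℤ) ^ j)) hm j).toLocal (Sum.inr v)) 1)
        (κ.eisensteinLocalReduce (fun j ↦ V.torsionGaloisModule (((3 : ℕ) : ℤ) ^ j)) (fun j ↦ V.torsionGaloisModuleReduce 3 j) hm
          (Sum.inr v)) 3
        (fun j ↦ (V.ordinaryFiltrationAt v (fun j ↦ V.torsionGaloisModuleReduce 3 j) (fun _ _ ↦ rfl)).ordinaryCore (κ := κ) hm j)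
        i).addSubgroupOf _) ≤ 3 ^ (3 ^ s) := by
  classical
  have hpp := Nat.prime_three
  have hpK : ((3 : ℕ) : K) ≠ 0 := by exact_mod_cast hpp.ne_zero
  haveI : CharZero (v.adicCompletion K) := charZero_of_injective_algebraMap (algebraMap K _).injective
  -- finiteness of the levels
  haveI hfinE : ∀ j, Finite (geomTorsion V (((3 : ℕ) : ℤ) ^ j)) := fun j ↦
    finite_torsionPoints_holds V (AlgebraicClosure K) (n := ((3 : ℕ) : ℤ) ^ j) (pow_ne_zero _ (by exact_mod_cast hpp.ne_zero))
  haveI hfinM : ∀ j, Finite (EisensteinLevel 3 m (fun j ↦ geomTorsion V (((3 : ℕ) : ℤ) ^ j)) j) := fun j ↦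
    EisensteinCoeff.finite_twisted (p := 3) (k := j) (M := geomTorsion V (((3 : ℕ) : ℤ) ^ j)) hm
  /- ### A. the plain local presented family at `v` -/
  let Fam : ∀ a b, (κ.eisensteinTwist (V.torsionGaloisModule (((3 : ℕ) : ℤ) ^ a)) hm a).toContRepresentation →ⁱL
      (κ.eisensteinTwist (V.torsionGaloisModule (((3 : ℕ) : ℤ) ^ b)) hm b).toContRepresentation :=
    fun a b ↦ V.eisensteinTwistTorsionTransfer κ hm (fun j ↦ V.torsionGaloisModuleReduce 3 j) (fun _ _ ↦ rfl) a b
  let ρloc : ∀ a, DiscreteGaloisModule (v.adicCompletion K) (EisensteinLevel 3 m (fun j ↦ geomTorsion V (((3 : ℕ) : ℤ) ^ j)) a) :=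
    fun a ↦ (κ.eisensteinTwist (V.torsionGaloisModule (((3 : ℕ) : ℤ) ^ a)) hm a).toLocal (Sum.inr v)
  let floc : ∀ a b, (ρloc a).toContRepresentation →ⁱL (ρloc b).toContRepresentation :=
    fun a b ↦ Literature.NumberTheory.EllipticCurves.DiscreteGaloisModule.localMap (Fam a b) (Sum.inr v)
  have hid : ∀ a (x : EisensteinLevel 3 m (fun j ↦ geomTorsion V (((3 : ℕ) : ℤ) ^ j)) a), floc a a x = x :=
    fun a x ↦ κ.eisensteinTwistTransfer_self (fun k ↦ V.torsionGaloisModule (((3 : ℕ) : ℤ) ^ k))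
      (fun j ↦ V.torsionGaloisModuleReduce 3 j) hm _ _ _ a x
  have hcomp : ∀ a b c', c' ≤ b → b ≤ a →
      ∀ x : EisensteinLevel 3 m (fun j ↦ geomTorsion V (((3 : ℕ) : ℤ) ^ j)) a, floc b c' (floc a b x) = floc a c' x :=
    fun a b c' hcb hba x ↦ κ.eisensteinTwistTransfer_comp (fun k ↦ V.torsionGaloisModule (((3 : ℕ) : ℤ) ^ k))
      (fun j ↦ V.torsionGaloisModuleReduce 3 j) hm _ _ _ hcb hba x
  have hinj : ∀ ℓ n, Function.Injective (floc ℓ (ℓ + n)) :=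
    fun ℓ n ↦ V.eisensteinTwistTorsionTransfer_injective κ hm (fun j ↦ V.torsionGaloisModuleReduce 3 j) (fun _ _ ↦ rfl) ℓ n
  have hex : ∀ ℓ n (y : EisensteinLevel 3 m (fun j ↦ geomTorsion V (((3 : ℕ) : ℤ) ^ j)) (ℓ + n)),
      floc (ℓ + n) n y = 0 ↔ ∃ x, floc ℓ (ℓ + n) x = y :=
    fun ℓ n y ↦ κ.eisensteinTwistTransfer_eq_zero_iff_exists (fun k ↦ V.torsionGaloisModule (((3 : ℕ) : ℤ) ^ k))
      (fun j ↦ V.torsionGaloisModuleReduce 3 j) hm _ _ _ ℓ n y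
  /- ### B. the Fil sub-tower at `v`, its presented family `g`, and its `H¹` -/
  let Fil : ∀ a, Submodule ℤ (EisensteinLevel 3 m (fun j ↦ geomTorsion V (((3 : ℕ) : ℤ) ^ j)) a) := fun a ↦
    (V.ordinaryFiltrationAt v (fun j ↦ V.torsionGaloisModuleReduce 3 j) (fun _ _ ↦ rfl)).twistedFil (p := 3) (m := m) a
  have hΓ : ∀ a (σ : absoluteGaloisGroup (v.adicCompletion K)), Fil a ≤ (Fil a).comap (ρloc a σ) := fun a σ ↦
    (V.ordinaryFiltrationAt v (fun j ↦ V.torsionGaloisModuleReduce 3 j) (fun _ _ ↦ rfl)).twistedFil_le_comap (κ := κ) hm a σ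
  have hmapv : ∀ a b, ∀ w ∈ Fil a, floc a b w ∈ Fil b := fun a b w hw ↦
    V.eisensteinTwistTransfer_mem_twistedFil_ordinaryFiltrationAt_of_hasMultiplicativeReductionAt_three v κ hm
      (fun j ↦ V.torsionGaloisModuleReduce 3 j) (fun _ _ ↦ rfl) hpv hmult a b w hw
  have honto : ∀ ℓ n, ∀ w' ∈ Fil n, ∃ w ∈ Fil (ℓ + n), floc (ℓ + n) n w = w' := fun ℓ n w' hw' ↦
    V.exists_mem_twistedFil_transfer_eq_ordinaryFiltrationAt_of_hasMultiplicativeReductionAt_three v κ hm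
      (fun j ↦ V.torsionGaloisModuleReduce 3 j) (fun _ _ ↦ rfl) hpv hmult ℓ n w' hw'
  have hsat : ∀ ℓ n (w : EisensteinLevel 3 m (fun j ↦ geomTorsion V (((3 : ℕ) : ℤ) ^ j)) ℓ),
      floc ℓ (ℓ + n) w ∈ Fil (ℓ + n) → w ∈ Fil ℓ := fun ℓ n w hw ↦
    V.mem_twistedFil_of_transfer_mem_ordinaryFiltrationAt_of_hasMultiplicativeReductionAt_three v κ hm
      (fun j ↦ V.torsionGaloisModuleReduce 3 j) (fun _ _ ↦ rfl) hpv hmult ℓ n w hw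
  obtain ⟨g, hg⟩ := Tower.exists_subFamily_apply_eq ρloc floc Fil hΓ hmapv
  let ρF : ∀ j, DiscreteGaloisModule (v.adicCompletion K) (Fil j) := fun j ↦ (ρloc j).subrepresentation (Fil j) (hΓ j)
  haveI hfinF : ∀ j, Finite (galoisCohomology (ρF j) 1) := fun j ↦ finite_galoisCohomology_one_adicCompletion v (ρF j)
  -- the `H¹`-tower of the Fil sub-tower, presented by `H¹(g a b)`
  let gH : ∀ a b, galoisCohomology (ρF a) 1 →+ galoisCohomology (ρF b) 1 := fun a b ↦ galoisCohomology.map (g a b) 1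
  have hgid : ∀ a (y : galoisCohomology (ρF a) 1), gH a a y = y := fun a y ↦
    Tower.map_apply_eq_self_of_forall_apply_eq (g a a) (fun w ↦ Subtype.ext (by rw [hg]; exact hid a w)) y
  have hgcomp : ∀ a b c', c' ≤ b → b ≤ a → ∀ y : galoisCohomology (ρF a) 1, gH b c' (gH a b y) = gH a c' y :=
    fun a b c' hcb hba y ↦ galoisCohomology.map_map_of_comp_apply (g a b) (g b c') (g a c')
      (fun w ↦ Subtype.ext (by rw [hg, hg, hg]; exact (hcomp a b c' hcb hba w).symm)) y
  -- the inclusions `ι_j = H¹(subtype)` into the `H¹`-tower of the plain levels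
  let ι : ∀ j, galoisCohomology (ρF j) 1 →+
      galoisCohomology ((κ.eisensteinTwist (V.torsionGaloisModule (((3 : ℕ) : ℤ) ^ j)) hm j).toLocal (Sum.inr v)) 1 :=
    fun j ↦ (cohomologyMap (subtypeHom (ρloc j) (Fil j) (hΓ j)) 1).hom.toLinearMap.toAddMonoidHom
  have hιdef : ∀ j (y : galoisCohomology (ρF j) 1), ι j y = cohomologyMap (subtypeHom (ρloc j) (Fil j) (hΓ j)) 1 y :=
    fun _ _ ↦ rfl
  -- the reductions of the plain local tower are `H¹(floc (j+1) j)`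
  have hred : ∀ (j : ℕ) (x : galoisCohomology (ρloc (j + 1)) 1),
      κ.eisensteinLocalReduce (fun j ↦ V.torsionGaloisModule (((3 : ℕ) : ℤ) ^ j)) (fun j ↦ V.torsionGaloisModuleReduce 3 j) hm
        (Sum.inr v) j x = galoisCohomology.map (floc (j + 1) j) 1 x := by
    intro j x
    have e1 : floc (j + 1) j = Literature.NumberTheory.EllipticCurves.DiscreteGaloisModule.localMap
        (κ.eisensteinTwistReduce hm (Nat.le_succ j) (V.torsionGaloisModuleReduce 3 j)) (Sum.inr v) := by
      change Literature.NumberTheory.EllipticCurves.DiscreteGaloisModule.localMap (κ.eisensteinTwistTransfer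
        (fun k ↦ V.torsionGaloisModule (((3 : ℕ) : ℤ) ^ k)) (fun j ↦ V.torsionGaloisModuleReduce 3 j) hm _ _ _ (j + 1) j)
        (Sum.inr v) = _
      rw [κ.eisensteinTwistTransfer_succ_self]
    rw [e1]
    rfl
  have hι : ∀ (j : ℕ) (y : galoisCohomology (ρF (j + 1)) 1),
      κ.eisensteinLocalReduce (fun j ↦ V.torsionGaloisModule (((3 : ℕ) : ℤ) ^ j)) (fun j ↦ V.torsionGaloisModuleReduce 3 j) hm
        (Sum.inr v) j (ι (j + 1) y) = ι j (gH (j + 1) j y) := by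
    intro j y
    rw [hred, hιdef, hιdef]
    exact Tower.map_subtypeHom_eq_subtypeHom_map (ρ := ρloc) (f := floc) (Fil := Fil) (hΓ := hΓ) hg (j + 1) j y
  have hC : ∀ (j : ℕ) (y : galoisCohomology (ρF j) 1),
      ι j y ∈ (V.ordinaryFiltrationAt v (fun j ↦ V.torsionGaloisModuleReduce 3 j) (fun _ _ ↦ rfl)).ordinaryCore
        (κ := κ) hm j := fun j y ↦
    (Tower.mem_strictSubgroup_iff_exists_map_subtypeHom_eq (ρ := ρloc) (Fil := Fil) (hΓ := hΓ) j _).2 ⟨y, rfl⟩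
  -- the core IS the image of `ι_i`
  have hrange : (ι i).range =
      (V.ordinaryFiltrationAt v (fun j ↦ V.torsionGaloisModuleReduce 3 j) (fun _ _ ↦ rfl)).ordinaryCore (κ := κ) hm i := by
    ext x
    rw [AddMonoidHom.mem_range]
    exact (Tower.mem_strictSubgroup_iff_exists_map_subtypeHom_eq (ρ := ρloc) (Fil := Fil) (hΓ := hΓ) i x).symm
  /- ### C. the cokernel bound `#(H¹(Fil_i) ⧸ im H¹(Fil_j → Fil_i)) ≤ p^{p^s}` for `j ≥ i` -/
  have hB : ∀ j, i ≤ j → Nat.card (galoisCohomology (ρF i) 1 ⧸ (gH j i).range) ≤ 3 ^ (3 ^ s) := by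
    intro j hij
    rcases hij.eq_or_lt with rfl | hlt
    · -- `j = i`: the image is everything
      have htop : (gH i i).range = ⊤ := AddMonoidHom.range_eq_top.2 fun y ↦ ⟨y, hgid i y⟩
      rw [htop]
      haveI : Subsingleton (galoisCohomology (ρF i) 1 ⧸ (⊤ : AddSubgroup (galoisCohomology (ρF i) 1))) :=
        QuotientAddGroup.subsingleton_quotient_top
      calc Nat.card (galoisCohomology (ρF i) 1 ⧸ (⊤ : AddSubgroup (galoisCohomology (ρF i) 1))) ≤ 1 :=
            Finite.card_le_one_iff_subsingleton.mpr inferInstance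
        _ ≤ 3 ^ (3 ^ s) := Nat.one_le_pow _ _ hpp.pos
    · -- `j = n + i`, `n ≥ 1`: the row `0 → Fil_n → Fil_{n+i} → Fil_i → 0` and `#H²(K_v, Fil_n) ≤ p^{p^s}`
      obtain ⟨n, rfl⟩ := Nat.exists_eq_add_of_le' hlt.le
      have hn : 1 ≤ n := by omega
      have hSES := Tower.isSES_subFamily (ρ := ρloc) (f := floc) (Fil := Fil) (hΓ := hΓ) hg hinj hex honto hsat n i
      -- the `H²`-bound on the twisted plus line at level `n`
      obtain ⟨P₀, hP₀, hgen⟩ := V.exists_generator_torsionFilAt_of_hasMultiplicativeReductionAt_three v hpv hmult n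
      have hgen' : ∀ a ∈ (V.ordinaryFiltrationAt v (fun j ↦ V.torsionGaloisModuleReduce 3 j) (fun _ _ ↦ rfl)).fil n,
          ∃ c : ℤ, c • P₀ = a := fun a ha ↦ by
        obtain ⟨c, hc⟩ := hgen a ha
        exact ⟨c, hc.symm⟩
      have hσP₀ : GaloisRep.toLocal v (V.torsionGaloisModule (((3 : ℕ) : ℤ) ^ n)) σ₀ P₀ ∈ V.torsionFilAt v (((3 : ℕ) : ℤ) ^ n) :=
        V.smul_mem_torsionFilAt v _ σ₀ P₀ hP₀
      obtain ⟨lam, hlam⟩ := hgen _ hσP₀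
      obtain ⟨c, hc, hcp⟩ := exists_int_mu_apply_eq_zsmul_not_dvd (v.adicCompletion K) (p := 3) hn σ₀
      obtain ⟨hfin2, h2le⟩ :=
        (V.ordinaryFiltrationAt v (fun j ↦ V.torsionGaloisModuleReduce 3 j) (fun _ _ ↦ rfl)).natCard_two_twistedFil_le
          κ hm n hn P₀ hP₀ hgen' hσ hms lam hlam c hc hcp
      haveI : Finite (continuousCohomology 2 (ρF n).toTopRep) := hfin2
      obtain ⟨-, hle⟩ := hSES.natCard_quotient_range_cohomologyMap_one_le
      exact hle.trans h2le
  /- ### D. the generic index bound -/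
  have hmain := Tower.natCard_range_quotient_levelCondition_le gH hgid hgcomp
    (red := κ.eisensteinLocalReduce (fun j ↦ V.torsionGaloisModule (((3 : ℕ) : ℤ) ^ j))
      (fun j ↦ V.torsionGaloisModuleReduce 3 j) hm (Sum.inr v))
    ι hι 3 (fun j ↦ (V.ordinaryFiltrationAt v (fun j ↦ V.torsionGaloisModuleReduce 3 j) (fun _ _ ↦ rfl)).ordinaryCore
      (κ := κ) hm j) hC i (3 ^ (3 ^ s)) hB
  rw [hrange] at hmain
  exact hmain

end WeierstrassCurve

end
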